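import Literature.NumberTheory.ConnesMoscovici2022.UVProlateSymmetryReduction
import Literature.NumberTheory.ConnesMoscovici2022.UVProlateMaxDomainAsymptotics
import Literature.NumberTheory.ConnesMoscovici2022.UVProlateSADomain

/-!
# RH-FREE. Connes–Moscovici 2022, Thm 1.6 (i), symmetric half: the `±∞` boundary term from the
# boundary conditions (1.20)/(1.21) — parity split, transfer to the regular representative, and the
# limit algebra, ASSUMING the general `+∞` asymptotics of `dom W_max` elements

LINE 1 FRAMING: RH-FREE corpus literature (cell rh-crit, C1 Connes–Consani/Moscovici corpus, row O2
`UVProlateSpectrum`; Sturm–Liouville bookkeeping for `W_λ = −∂ₓ(λ² − x²)∂ₓ + (2πλx)²`).  bears_on: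
W-C/W-P only (sequel material, no leaf role).  WHAT THIS IS NOT: nothing here bears on the truth of
RH; no statement about zeta zeros; theorems only (0 defs, 0 named facts); `CM22_thm_1_6` stays a
named fact.

## What is proved (stage (D-asm) of the cell's cut for Thm 1.6 (i), seat cc-t6)

Companion of `UVProlateSymmetryReduction` (which reduces `⟪W_max ξ₁, ξ₂⟫ = ⟪ξ₁, W_max ξ₂⟫` on
`𝓛_β = prolateSASet λ` to `BF(R) − BF(−R) → 0`, `BF` the sesquilinear Lagrange boundary form of a
pair of regular representatives).  Here:

* parity algebra — `evenFn g`, `oddFn g` of a regular representative are again `C¹` off `{±λ}`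
  with the FTC form of `(p h′)′ = q h − η^{±}` (`η^{±}` the even/odd part of `η = W_max ξ`), and
  `BF(R) − BF(−R) = 2·(λ² − R²)·(W⁺⁺(R) + W⁻⁻(R))` (`W^{±±}` the sesquilinear Wronskians of the
  even/odd parts; the mixed terms are even in `R` and cancel);
* transfer of the boundary conditions (1.20)/(1.21) at `+∞` from the `ProlateBC` representative to
  the regular representative (they agree off `{±λ}`, hence so do their derivatives);
* the limit algebra: if `x h(x) − (A sin ωx + B cos ωx) → 0` and `(h + x h′) − ω(A cos ωx − B sin ωx)
  → 0` (`ω = 2πλ`), then (1.20) for `h` forces `B = 0`, (1.21) forces `A = 0`, and for two such `h`'s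
  with `B₁ = B₂ = 0` (resp. `A₁ = A₂ = 0`) the form `(λ² − x²)·(conj h₁ · h₂′ − conj h₁′ · h₂)(x) → 0`;
* `inner_prolateMax_symm_of_mem_prolateSASet`: for `ξ₁, ξ₂ ∈ prolateSASet λ`,
  `⟪W_max ξ₁, ξ₂⟫ = ⟪ξ₁, W_max ξ₂⟫`, with the general `+∞` asymptotics of elements of `dom W_max`
  as an explicit hypothesis `hB` (for `g ∈ C¹(x₀, ∞) ∩ L²`, `x₀ > λ`, with `p g′` a primitive of
  `q g − η`, `η ∈ L²(x₀, ∞)`: `∃ A B, x g(x) − (A sin ωx + B cos ωx) → 0` and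
  `(g + x g′)(x) − ω(A cos ωx − B sin ωx) → 0`);
* **`inner_prolateMax_symm`** (UNCONDITIONAL): `hB` discharged by the companion module
  `UVProlateMaxDomainAsymptotics` (`exists_asymptotics_atTop_of_ftc`, seat cc-t14), so
  **Thm 1.6 (i), "`W_sa` is symmetric", holds for THE operator**: `Ω ≡ 0` on `𝓛_β × 𝓛_β`;
  `isSymmetric_of_isProlateSA` restates it as `W.IsSymmetric` for any `W` with `IsProlateSA λ W`,
  and `prolateSA_isSymmetric` for the tree's operator `prolateSA λ`.

Printed source: [ConnesMoscovici2022] = arXiv:2112.05500v1: the boundary functionals (1.18) and the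
boundary conditions (1.19)–(1.21) (chunk p0006:L9–L24, L55–L69), «one can always restrict the
computation to `ℝ⁺`» (parity, chunk p0005:L57–L61 and p0006:L4–L5), and the proof of Thm 2.6 (i)
(chunk p0006:L81–L83: "selfadjoint by construction").  DEVIATION: the printed text obtains the
vanishing of `Ω` on `𝓛_β × 𝓛_β` from the symplectic linear algebra of the deficiency basis
(Lemma 1.5); here the boundary terms of Green's formula (1.7) are evaluated directly from
(1.19)–(1.21) and the `+∞` asymptotics, which is the computation behind (1.18).  Cell rh-crit seat
cc-t6 g4 (cut of record cc/STATUS R135 (2)).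
-/

noncomputable section

open Complex Set MeasureTheory Filter Topology intervalIntegral
open scoped Real Topology ContDiff InnerProductSpace ComplexConjugate

namespace Literature.NumberTheory.ConnesMoscovici2022

open Literature.NumberTheory.ConnesConsani2021 Literature.NumberTheory.ConnesConsani2024

/-! ## Small helpers -/

section Helpers

variable {lam : ℝ}

/-- `ℝ ∖ {±λ}` is symmetric under `x ↦ −x`. [folklore] -/
private theorem neg_mem_U {x : ℝ} (hx : x ∈ {x : ℝ | x ≠ lam ∧ x ≠ -lam}) :
    -x ∈ {x : ℝ | x ≠ lam ∧ x ≠ -lam} :=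
  ⟨fun h ↦ hx.2 (by linarith), fun h ↦ hx.1 (by linarith)⟩

/-- `ℝ ∖ {±λ}` is open. [folklore] -/
private theorem isOpen_U' (lam : ℝ) : IsOpen {x : ℝ | x ≠ lam ∧ x ≠ -lam} :=
  isOpen_ne.and isOpen_ne

/-- `p` is even. [folklore] -/
private theorem pCoeff_neg (lam x : ℝ) : pCoeff lam (-x) = pCoeff lam x := by
  simp [pCoeff]

/-- `q` is even. [folklore] -/
private theorem qCoeff_neg (lam x : ℝ) : qCoeff lam (-x) = qCoeff lam x := by
  simp [qCoeff]

/-- `star p = p`. [folklore] -/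
private theorem star_pCoeff' (lam x : ℝ) : star (pCoeff lam x) = pCoeff lam x := by
  rw [pCoeff]; exact Complex.conj_ofReal _

/-- A `C¹` function on the open set `ℝ ∖ {±λ}` is differentiable at each of its points. [folklore] -/
private theorem differentiableAt_of_contDiffOn {g : ℝ → ℂ}
    (hg : ContDiffOn ℝ 1 g {x | x ≠ lam ∧ x ≠ -lam}) {x : ℝ} (hx : x ∈ {x : ℝ | x ≠ lam ∧ x ≠ -lam}) :
    DifferentiableAt ℝ g x :=
  (hg.differentiableOn one_ne_zero x hx).differentiableAt ((isOpen_U' lam).mem_nhds hx)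

end Helpers

/-! ## Parity algebra for regular representatives -/

section Parity

variable {lam : ℝ} {g η : ℝ → ℂ}

/-- RH-FREE (PROVED). The derivative of the even part: `(ξ⁺)′(x) = (ξ′(x) − ξ′(−x))/2`.
[cite: ConnesMoscovici2022, §1, parity decomposition before Thm 1.6 (= arXiv chunk p0006:L60–L69)] -/
theorem hasDerivAt_evenFn {x : ℝ} (h₁ : DifferentiableAt ℝ g x) (h₂ : DifferentiableAt ℝ g (-x)) :
    HasDerivAt (evenFn g) ((deriv g x - deriv g (-x)) / 2) x := by
  have hn : HasDerivAt (fun y : ℝ ↦ g (-y)) (-deriv g (-x)) x := by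
    simpa [Function.comp_def] using HasDerivAt.scomp x h₂.hasDerivAt (hasDerivAt_neg' x)
  have h := (h₁.hasDerivAt.add hn).div_const 2
  rw [show (deriv g x - deriv g (-x)) / 2 = (deriv g x + -deriv g (-x)) / 2 by ring]
  exact h

/-- RH-FREE (PROVED). The derivative of the odd part: `(ξ⁻)′(x) = (ξ′(x) + ξ′(−x))/2`.
[cite: ConnesMoscovici2022, §1, parity decomposition before Thm 1.6 (= arXiv chunk p0006:L60–L69)] -/
theorem hasDerivAt_oddFn {x : ℝ} (h₁ : DifferentiableAt ℝ g x) (h₂ : DifferentiableAt ℝ g (-x)) :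
    HasDerivAt (oddFn g) ((deriv g x + deriv g (-x)) / 2) x := by
  have hn : HasDerivAt (fun y : ℝ ↦ g (-y)) (-deriv g (-x)) x := by
    simpa [Function.comp_def] using HasDerivAt.scomp x h₂.hasDerivAt (hasDerivAt_neg' x)
  have h := (h₁.hasDerivAt.sub hn).div_const 2
  rw [show (deriv g x + deriv g (-x)) / 2 = (deriv g x - -deriv g (-x)) / 2 by ring]
  exact h

/-- RH-FREE (PROVED). The even part of a `C¹` function off `{±λ}` is `C¹` off `{±λ}`.
[cite: ConnesMoscovici2022, §1, parity decomposition before Thm 1.6 (= arXiv chunk p0006:L60–L69)] -/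
theorem contDiffOn_evenFn (hg : ContDiffOn ℝ 1 g {x | x ≠ lam ∧ x ≠ -lam}) :
    ContDiffOn ℝ 1 (evenFn g) {x | x ≠ lam ∧ x ≠ -lam} := by
  have hneg : ContDiffOn ℝ 1 (fun x ↦ g (-x)) {x | x ≠ lam ∧ x ≠ -lam} :=
    hg.comp contDiff_neg.contDiffOn fun x hx ↦ neg_mem_U hx
  show ContDiffOn ℝ 1 (fun x ↦ (g x + g (-x)) / 2) {x | x ≠ lam ∧ x ≠ -lam}
  exact (hg.add hneg).div_const 2

/-- RH-FREE (PROVED). The odd part of a `C¹` function off `{±λ}` is `C¹` off `{±λ}`.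
[cite: ConnesMoscovici2022, §1, parity decomposition before Thm 1.6 (= arXiv chunk p0006:L60–L69)] -/
theorem contDiffOn_oddFn (hg : ContDiffOn ℝ 1 g {x | x ≠ lam ∧ x ≠ -lam}) :
    ContDiffOn ℝ 1 (oddFn g) {x | x ≠ lam ∧ x ≠ -lam} := by
  have hneg : ContDiffOn ℝ 1 (fun x ↦ g (-x)) {x | x ≠ lam ∧ x ≠ -lam} :=
    hg.comp contDiff_neg.contDiffOn fun x hx ↦ neg_mem_U hx
  show ContDiffOn ℝ 1 (fun x ↦ (g x - g (-x)) / 2) {x | x ≠ lam ∧ x ≠ -lam}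
  exact (hg.sub hneg).div_const 2

/-- RH-FREE (PROVED). `deriv` of the even part off `{±λ}`.
[cite: ConnesMoscovici2022, §1, parity decomposition before Thm 1.6 (= arXiv chunk p0006:L60–L69)] -/
theorem deriv_evenFn_of_mem (hg : ContDiffOn ℝ 1 g {x | x ≠ lam ∧ x ≠ -lam}) {x : ℝ}
    (hx : x ∈ {x : ℝ | x ≠ lam ∧ x ≠ -lam}) :
    deriv (evenFn g) x = (deriv g x - deriv g (-x)) / 2 :=
  (hasDerivAt_evenFn (differentiableAt_of_contDiffOn hg hx)
    (differentiableAt_of_contDiffOn hg (neg_mem_U hx))).deriv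

/-- RH-FREE (PROVED). `deriv` of the odd part off `{±λ}`.
[cite: ConnesMoscovici2022, §1, parity decomposition before Thm 1.6 (= arXiv chunk p0006:L60–L69)] -/
theorem deriv_oddFn_of_mem (hg : ContDiffOn ℝ 1 g {x | x ≠ lam ∧ x ≠ -lam}) {x : ℝ}
    (hx : x ∈ {x : ℝ | x ≠ lam ∧ x ≠ -lam}) :
    deriv (oddFn g) x = (deriv g x + deriv g (-x)) / 2 :=
  (hasDerivAt_oddFn (differentiableAt_of_contDiffOn hg hx)
    (differentiableAt_of_contDiffOn hg (neg_mem_U hx))).deriv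

/-- Interval integrability of `q g − η` and of its reflection on `[x, y] ⊆ ℝ ∖ {±λ}`. [folklore] -/
private theorem intervalIntegrable_f_and_reflect (hg : ContDiffOn ℝ 1 g {x | x ≠ lam ∧ x ≠ -lam})
    (hη : ∀ a b, IntervalIntegrable η volume a b) {x y : ℝ} (hxy : x ≤ y)
    (hI : Icc x y ⊆ {x | x ≠ lam ∧ x ≠ -lam}) :
    IntervalIntegrable (fun t ↦ qCoeff lam t * g t - η t) volume x y ∧
      IntervalIntegrable (fun t ↦ qCoeff lam (-t) * g (-t) - η (-t)) volume x y := by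
  have hqc : Continuous (qCoeff lam) := by
    unfold qCoeff; fun_prop
  have hgc : ContinuousOn g (Icc x y) := hg.continuousOn.mono hI
  have h1 : IntervalIntegrable (fun t ↦ qCoeff lam t * g t) volume x y :=
    ((hqc.continuousOn.mul hgc).mono (by rw [uIcc_of_le hxy])).intervalIntegrable
  have hI' : Icc (-y) (-x) ⊆ {x | x ≠ lam ∧ x ≠ -lam} := by
    intro t ht
    have := neg_mem_U (lam := lam) (hI ⟨by linarith [ht.2], by linarith [ht.1]⟩ : -t ∈ _)
    simpa using this
  have hgc' : ContinuousOn (fun t ↦ g (-t)) (Icc x y) := by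
    refine (hg.continuousOn.mono hI').comp continuous_neg.continuousOn ?_
    intro t ht; exact ⟨by linarith [ht.2], by linarith [ht.1]⟩
  have h2 : IntervalIntegrable (fun t ↦ qCoeff lam (-t) * g (-t)) volume x y :=
    (((hqc.comp continuous_neg).continuousOn.mul hgc').mono
      (by rw [uIcc_of_le hxy])).intervalIntegrable
  have h3 : IntervalIntegrable (fun t ↦ η (-t)) volume x y := by
    have := (IntervalIntegrable.iff_comp_neg (f := η) (a := -x) (b := -y)).1 (hη (-x) (-y))
    simpa using this
  exact ⟨h1.sub (hη x y), h2.sub h3⟩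

/-- RH-FREE (PROVED). **FTC form for the even part**: if `p g′` is a primitive of `q g − η` on every
`[x, y] ⊆ ℝ ∖ {±λ}`, then `p (g⁺)′` is a primitive of `q g⁺ − η⁺` there (`p, q` even).
[cite: ConnesMoscovici2022, §1, «restrict the computation to ℝ⁺» (= arXiv chunk p0006:L4–L5, L60–L69)] -/
theorem ftc_evenFn (hg : ContDiffOn ℝ 1 g {x | x ≠ lam ∧ x ≠ -lam})
    (hftc : ∀ x y, x ≤ y → Icc x y ⊆ {x | x ≠ lam ∧ x ≠ -lam} →
      pCoeff lam y * deriv g y - pCoeff lam x * deriv g x =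
        ∫ t in x..y, (qCoeff lam t * g t - η t))
    (hη : ∀ a b, IntervalIntegrable η volume a b) :
    ∀ x y, x ≤ y → Icc x y ⊆ {x | x ≠ lam ∧ x ≠ -lam} →
      pCoeff lam y * deriv (evenFn g) y - pCoeff lam x * deriv (evenFn g) x =
        ∫ t in x..y, (qCoeff lam t * evenFn g t - evenFn η t) := by
  intro x y hxy hI
  have hx : x ∈ {x : ℝ | x ≠ lam ∧ x ≠ -lam} := hI (left_mem_Icc.2 hxy)
  have hy : y ∈ {x : ℝ | x ≠ lam ∧ x ≠ -lam} := hI (right_mem_Icc.2 hxy)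
  have hI' : Icc (-y) (-x) ⊆ {x | x ≠ lam ∧ x ≠ -lam} := by
    intro t ht
    have := neg_mem_U (lam := lam) (hI ⟨by linarith [ht.2], by linarith [ht.1]⟩ : -t ∈ _)
    simpa using this
  have e1 := hftc x y hxy hI
  have e2 := hftc (-y) (-x) (by linarith) hI'
  obtain ⟨hi1, hi2⟩ := intervalIntegrable_f_and_reflect hg hη hxy hI
  rw [deriv_evenFn_of_mem hg hx, deriv_evenFn_of_mem hg hy]
  have ecomp : ∫ t in x..y, (qCoeff lam (-t) * g (-t) - η (-t)) =
      ∫ t in (-y)..(-x), (qCoeff lam t * g t - η t) :=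
    intervalIntegral.integral_comp_neg (f := fun t ↦ qCoeff lam t * g t - η t)
  have key : ∫ t in x..y, (qCoeff lam t * evenFn g t - evenFn η t) =
      (1 / 2 * ∫ t in x..y, (qCoeff lam t * g t - η t)) +
        (1 / 2 * ∫ t in x..y, (qCoeff lam (-t) * g (-t) - η (-t))) := by
    rw [← intervalIntegral.integral_const_mul, ← intervalIntegral.integral_const_mul,
      ← intervalIntegral.integral_add (hi1.const_mul _) (hi2.const_mul _)]
    congr 1
    funext t
    simp only [evenFn, qCoeff_neg]
    ring
  rw [key, ecomp, ← e1, ← e2, pCoeff_neg, pCoeff_neg]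
  ring

/-- RH-FREE (PROVED). **FTC form for the odd part** (same statement with `g⁻`, `η⁻`).
[cite: ConnesMoscovici2022, §1, «restrict the computation to ℝ⁺» (= arXiv chunk p0006:L4–L5, L60–L69)] -/
theorem ftc_oddFn (hg : ContDiffOn ℝ 1 g {x | x ≠ lam ∧ x ≠ -lam})
    (hftc : ∀ x y, x ≤ y → Icc x y ⊆ {x | x ≠ lam ∧ x ≠ -lam} →
      pCoeff lam y * deriv g y - pCoeff lam x * deriv g x =
        ∫ t in x..y, (qCoeff lam t * g t - η t))
    (hη : ∀ a b, IntervalIntegrable η volume a b) :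
    ∀ x y, x ≤ y → Icc x y ⊆ {x | x ≠ lam ∧ x ≠ -lam} →
      pCoeff lam y * deriv (oddFn g) y - pCoeff lam x * deriv (oddFn g) x =
        ∫ t in x..y, (qCoeff lam t * oddFn g t - oddFn η t) := by
  intro x y hxy hI
  have hx : x ∈ {x : ℝ | x ≠ lam ∧ x ≠ -lam} := hI (left_mem_Icc.2 hxy)
  have hy : y ∈ {x : ℝ | x ≠ lam ∧ x ≠ -lam} := hI (right_mem_Icc.2 hxy)
  have hI' : Icc (-y) (-x) ⊆ {x | x ≠ lam ∧ x ≠ -lam} := by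
    intro t ht
    have := neg_mem_U (lam := lam) (hI ⟨by linarith [ht.2], by linarith [ht.1]⟩ : -t ∈ _)
    simpa using this
  have e1 := hftc x y hxy hI
  have e2 := hftc (-y) (-x) (by linarith) hI'
  obtain ⟨hi1, hi2⟩ := intervalIntegrable_f_and_reflect hg hη hxy hI
  rw [deriv_oddFn_of_mem hg hx, deriv_oddFn_of_mem hg hy]
  have ecomp : ∫ t in x..y, (qCoeff lam (-t) * g (-t) - η (-t)) =
      ∫ t in (-y)..(-x), (qCoeff lam t * g t - η t) :=
    intervalIntegral.integral_comp_neg (f := fun t ↦ qCoeff lam t * g t - η t)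
  have key : ∫ t in x..y, (qCoeff lam t * oddFn g t - oddFn η t) =
      (1 / 2 * ∫ t in x..y, (qCoeff lam t * g t - η t)) -
        (1 / 2 * ∫ t in x..y, (qCoeff lam (-t) * g (-t) - η (-t))) := by
    rw [← intervalIntegral.integral_const_mul, ← intervalIntegral.integral_const_mul,
      ← intervalIntegral.integral_sub (hi1.const_mul _) (hi2.const_mul _)]
    congr 1
    funext t
    simp only [oddFn, qCoeff_neg]
    ring
  rw [key, ecomp, ← e1, ← e2, pCoeff_neg, pCoeff_neg]
  ring

/-- RH-FREE (PROVED). **Parity split of the boundary form**: for `R` with `R, −R ∉ {±λ}`,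
`BF(R) − BF(−R) = 2·p(R)·(W⁺⁺(R) + W⁻⁻(R))`, where
`W^{±±} = conj(g₁^±)·(g₂^±)′ − conj((g₁^±)′)·g₂^±` (the mixed Wronskians are even and cancel).
[cite: ConnesMoscovici2022, §1, «one can always restrict the computation to ℝ⁺» (= arXiv chunk p0006:L4–L5)] -/
theorem boundaryForm_sub_reflect_eq {g₁ g₂ : ℝ → ℂ}
    (hg₁ : ContDiffOn ℝ 1 g₁ {x | x ≠ lam ∧ x ≠ -lam})
    (hg₂ : ContDiffOn ℝ 1 g₂ {x | x ≠ lam ∧ x ≠ -lam}) {R : ℝ}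
    (hR : R ∈ {x : ℝ | x ≠ lam ∧ x ≠ -lam}) :
    (star (g₁ R) * (pCoeff lam R * deriv g₂ R) - star (pCoeff lam R * deriv g₁ R) * g₂ R) -
      (star (g₁ (-R)) * (pCoeff lam (-R) * deriv g₂ (-R)) -
        star (pCoeff lam (-R) * deriv g₁ (-R)) * g₂ (-R)) =
      2 * pCoeff lam R *
        ((star (evenFn g₁ R) * deriv (evenFn g₂) R - star (deriv (evenFn g₁) R) * evenFn g₂ R) +
          (star (oddFn g₁ R) * deriv (oddFn g₂) R - star (deriv (oddFn g₁) R) * oddFn g₂ R)) := by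
  rw [deriv_evenFn_of_mem hg₁ hR, deriv_evenFn_of_mem hg₂ hR, deriv_oddFn_of_mem hg₁ hR,
    deriv_oddFn_of_mem hg₂ hR, pCoeff_neg]
  simp only [evenFn, oddFn, star_add, star_sub, star_mul', star_div₀, star_pCoeff', star_ofNat]
  ring


/-- RH-FREE (PROVED). The even part of an `L²` function is `L²`. [cite: ConnesMoscovici2022, §1,
parity decomposition `L²(ℝ) = L²₊ ⊕ L²₋` (= arXiv chunk p0005:L57–L61)] -/
theorem memLp_evenFn {g : ℝ → ℂ} (hg : MemLp g 2 volume) : MemLp (evenFn g) 2 volume := by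
  have hneg : MemLp (fun x ↦ g (-x)) 2 volume := by
    simpa [Function.comp_def] using
      hg.comp_measurePreserving (Measure.measurePreserving_neg (volume : Measure ℝ))
  have h := (hg.add hneg).const_mul (1 / 2 : ℂ)
  refine MemLp.ae_eq (Eventually.of_forall fun x ↦ ?_) h
  simp only [Pi.add_apply, evenFn]
  ring

/-- RH-FREE (PROVED). The odd part of an `L²` function is `L²`. [cite: ConnesMoscovici2022, §1,
parity decomposition `L²(ℝ) = L²₊ ⊕ L²₋` (= arXiv chunk p0005:L57–L61)] -/
theorem memLp_oddFn {g : ℝ → ℂ} (hg : MemLp g 2 volume) : MemLp (oddFn g) 2 volume := by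
  have hneg : MemLp (fun x ↦ g (-x)) 2 volume := by
    simpa [Function.comp_def] using
      hg.comp_measurePreserving (Measure.measurePreserving_neg (volume : Measure ℝ))
  have h := (hg.sub hneg).const_mul (1 / 2 : ℂ)
  refine MemLp.ae_eq (Eventually.of_forall fun x ↦ ?_) h
  simp only [Pi.sub_apply, oddFn]
  ring

/-- Square-integrability on any set of an `L²` function. [folklore] -/
private theorem integrableOn_sq_of_memLp {f : ℝ → ℂ} (hf : MemLp f 2 volume) (s : Set ℝ) :
    IntegrableOn (fun x ↦ ‖f x‖ ^ 2) s :=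
  ((memLp_two_iff_integrable_sq_norm hf.1).1 hf).integrableOn

/-- An `L²(ℝ)` class is integrable on bounded intervals. [folklore] -/
private theorem intervalIntegrable_coe' (η : L2R) (x y : ℝ) :
    IntervalIntegrable (fun t ↦ ((η : ℝ → ℂ)) t) volume x y :=
  (intervalIntegrable_iff').2
    ((((Lp.memLp η).locallyIntegrable (by norm_num)).integrableOn_isCompact isCompact_uIcc))

end Parity

/-! ## Transfer of the boundary conditions at `+∞` to the regular representative -/

section Transfer

variable {lam : ℝ} {g₀ g : ℝ → ℂ}

/-- Functions agreeing on the open set `ℝ ∖ {±λ}` have the same derivative there. [folklore] -/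
private theorem deriv_congr_of_eqOn {h₀ h : ℝ → ℂ}
    (heq : EqOn h₀ h {x : ℝ | x ≠ lam ∧ x ≠ -lam}) {x : ℝ}
    (hx : x ∈ {x : ℝ | x ≠ lam ∧ x ≠ -lam}) : deriv h₀ x = deriv h x :=
  (heq.eventuallyEq_of_mem ((isOpen_U' lam).mem_nhds hx)).deriv_eq

/-- Even parts of functions agreeing off `{±λ}` agree off `{±λ}`. [folklore] -/
private theorem evenFn_eqOn (heq : EqOn g₀ g {x : ℝ | x ≠ lam ∧ x ≠ -lam}) :
    EqOn (evenFn g₀) (evenFn g) {x : ℝ | x ≠ lam ∧ x ≠ -lam} := fun x hx ↦ by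
  simp only [evenFn, heq hx, heq (neg_mem_U hx)]

/-- Odd parts of functions agreeing off `{±λ}` agree off `{±λ}`. [folklore] -/
private theorem oddFn_eqOn (heq : EqOn g₀ g {x : ℝ | x ≠ lam ∧ x ≠ -lam}) :
    EqOn (oddFn g₀) (oddFn g) {x : ℝ | x ≠ lam ∧ x ≠ -lam} := fun x hx ↦ by
  simp only [oddFn, heq hx, heq (neg_mem_U hx)]

/-- RH-FREE (PROVED). **Transfer of (1.20)/(1.21) at `+∞`** from the `ProlateBC` representative
`g₀` (differentiable off `{±λ}`) to an a.e.-equal representative `g` that is `C¹` off `{±λ}`: the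
two agree off `{±λ}` (continuity), hence so do their even/odd parts and the derivatives of those,
so the boundary expressions coincide for `|x| > |λ|`.
[cite: ConnesMoscovici2022, §1 boundary conditions (1.20)–(1.21) (= arXiv (2.20)–(2.21), chunk p0006:L60–L69)] -/
theorem bcInf_transfer (h : g₀ =ᵐ[volume] g)
    (hd₀ : DifferentiableOn ℝ g₀ {x | x ≠ lam ∧ x ≠ -lam})
    (hg : ContDiffOn ℝ 1 g {x | x ≠ lam ∧ x ≠ -lam}) (hbc : ProlateBC lam g₀) :
    Tendsto (bcInfEven lam (evenFn g)) atTop (𝓝 0) ∧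
      Tendsto (bcInfOdd lam (oddFn g)) atTop (𝓝 0) := by
  have heq : EqOn g₀ g {x : ℝ | x ≠ lam ∧ x ≠ -lam} :=
    eqOn_of_ae_eq_of_continuousOn h hd₀.continuousOn hg.continuousOn
  have hev : ∀ᶠ x : ℝ in atTop, x ∈ {x : ℝ | x ≠ lam ∧ x ≠ -lam} := by
    filter_upwards [eventually_gt_atTop (max lam (-lam))] with x hx
    exact ⟨ne_of_gt (lt_of_le_of_lt (le_max_left _ _) hx),
      ne_of_gt (lt_of_le_of_lt (le_max_right _ _) hx)⟩
  constructor
  · refine hbc.evenTop.congr' ?_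
    filter_upwards [hev] with x hx
    simp only [bcInfEven, evenFn_eqOn heq hx, deriv_congr_of_eqOn (evenFn_eqOn heq) hx]
  · refine hbc.oddTop.congr' ?_
    filter_upwards [hev] with x hx
    simp only [bcInfOdd, oddFn_eqOn heq hx, deriv_congr_of_eqOn (oddFn_eqOn heq) hx]

end Transfer

/-! ## The limit algebra at `+∞` -/

section LimitAlgebra

variable {lam : ℝ} {l : Filter ℝ}

/-- `(→ 0) · (bounded) → 0`. [folklore] -/
private theorem tendsto_zero_mul_of_norm_le {e b : ℝ → ℂ} {C : ℝ} (he : Tendsto e l (𝓝 0))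
    (hb : ∀ᶠ x in l, ‖b x‖ ≤ C) : Tendsto (fun x ↦ e x * b x) l (𝓝 0) := by
  refine squeeze_zero_norm' ?_ (by simpa using he.norm.mul_const C)
  filter_upwards [hb] with x hx
  rw [norm_mul]
  exact mul_le_mul_of_nonneg_left hx (norm_nonneg _)

/-- `(bounded) · (→ 0) → 0`. [folklore] -/
private theorem tendsto_mul_zero_of_norm_le {b e : ℝ → ℂ} {C : ℝ} (hb : ∀ᶠ x in l, ‖b x‖ ≤ C)
    (he : Tendsto e l (𝓝 0)) : Tendsto (fun x ↦ b x * e x) l (𝓝 0) :=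
  (tendsto_zero_mul_of_norm_le he hb).congr fun _ ↦ mul_comm _ _

/-- `star r = r` for a real number seen in `ℂ`. [folklore] -/
private theorem star_ofReal' (r : ℝ) : star ((r : ℂ)) = (r : ℂ) := Complex.conj_ofReal r

/-- `|sin| ≤ 1` in `ℂ`-norm. [folklore] -/
private theorem norm_real_sin_le (y : ℝ) : ‖(Real.sin y : ℂ)‖ ≤ 1 := by
  rw [Complex.norm_real, Real.norm_eq_abs]; exact Real.abs_sin_le_one y

/-- `|cos| ≤ 1` in `ℂ`-norm. [folklore] -/
private theorem norm_real_cos_le (y : ℝ) : ‖(Real.cos y : ℂ)‖ ≤ 1 := by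
  rw [Complex.norm_real, Real.norm_eq_abs]; exact Real.abs_cos_le_one y

/-- `‖A sin + B cos‖ ≤ ‖A‖ + ‖B‖`. [folklore] -/
private theorem norm_sin_cos_comb_le (A B : ℂ) (y : ℝ) :
    ‖A * (Real.sin y : ℂ) + B * (Real.cos y : ℂ)‖ ≤ ‖A‖ + ‖B‖ := by
  refine (norm_add_le _ _).trans (add_le_add ?_ ?_)
  · rw [norm_mul]; exact mul_le_of_le_one_right (norm_nonneg _) (norm_real_sin_le y)
  · rw [norm_mul]; exact mul_le_of_le_one_right (norm_nonneg _) (norm_real_cos_le y)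

/-- `‖ω (A cos − B sin)‖ ≤ ‖ω‖ (‖A‖ + ‖B‖)`. [folklore] -/
private theorem norm_cos_sin_comb_le (w A B : ℂ) (y : ℝ) :
    ‖w * (A * (Real.cos y : ℂ) - B * (Real.sin y : ℂ))‖ ≤ ‖w‖ * (‖A‖ + ‖B‖) := by
  rw [norm_mul]
  refine mul_le_mul_of_nonneg_left ((norm_sub_le _ _).trans (add_le_add ?_ ?_)) (norm_nonneg _)
  · rw [norm_mul]; exact mul_le_of_le_one_right (norm_nonneg _) (norm_real_cos_le y)
  · rw [norm_mul]; exact mul_le_of_le_one_right (norm_nonneg _) (norm_real_sin_le y)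

/-- `sin² + cos² = 1` in `ℂ`. [folklore] -/
private theorem sin_sq_add_cos_sq' (y : ℝ) :
    (Real.sin y : ℂ) ^ 2 + (Real.cos y : ℂ) ^ 2 = 1 := by
  exact_mod_cast Real.sin_sq_add_cos_sq y

/-- (1.20)'s expression rearranged: `x sin ωx·h′ − (ωx cos ωx − sin ωx)·h
= sin ωx·(h + x h′) − ω cos ωx·(x h)`. [folklore] -/
private theorem bcInfEven_expand (lam : ℝ) (h : ℝ → ℂ) (x : ℝ) :
    bcInfEven lam h x = (Real.sin (2 * π * lam * x) : ℂ) * (h x + x * deriv h x) -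
      ((2 * π * lam : ℝ) : ℂ) * ((Real.cos (2 * π * lam * x) : ℂ) * ((x : ℂ) * h x)) := by
  simp only [bcInfEven]
  push_cast
  ring

/-- (1.21)'s expression rearranged: `x cos ωx·h′ + (ωx sin ωx + cos ωx)·h
= cos ωx·(h + x h′) + ω sin ωx·(x h)`. [folklore] -/
private theorem bcInfOdd_expand (lam : ℝ) (h : ℝ → ℂ) (x : ℝ) :
    bcInfOdd lam h x = (Real.cos (2 * π * lam * x) : ℂ) * (h x + x * deriv h x) +
      ((2 * π * lam : ℝ) : ℂ) * ((Real.sin (2 * π * lam * x) : ℂ) * ((x : ℂ) * h x)) := by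
  simp only [bcInfOdd]
  push_cast
  ring

/-- Abstract cancellation: if `Uᵢ − mᵢ → 0`, `Vᵢ − nᵢ → 0` with bounded models satisfying
`conj m₁ · n₂ = conj n₁ · m₂`, then `conj U₁ · V₂ − conj V₁ · U₂ → 0`. [folklore] -/
private theorem tendsto_form_zero_of_model {U₁ U₂ V₁ V₂ m₁ m₂ n₁ n₂ : ℝ → ℂ}
    {C₁ C₂ C₃ C₄ : ℝ} (hm₁ : ∀ᶠ x in l, ‖m₁ x‖ ≤ C₁) (hm₂ : ∀ᶠ x in l, ‖m₂ x‖ ≤ C₂)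
    (hn₁ : ∀ᶠ x in l, ‖n₁ x‖ ≤ C₃) (hn₂ : ∀ᶠ x in l, ‖n₂ x‖ ≤ C₄)
    (hid : ∀ x, star (m₁ x) * n₂ x = star (n₁ x) * m₂ x)
    (hU₁ : Tendsto (fun x ↦ U₁ x - m₁ x) l (𝓝 0)) (hU₂ : Tendsto (fun x ↦ U₂ x - m₂ x) l (𝓝 0))
    (hV₁ : Tendsto (fun x ↦ V₁ x - n₁ x) l (𝓝 0)) (hV₂ : Tendsto (fun x ↦ V₂ x - n₂ x) l (𝓝 0)) :
    Tendsto (fun x ↦ star (U₁ x) * V₂ x - star (V₁ x) * U₂ x) l (𝓝 0) := by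
  have key : ∀ x, star (U₁ x) * V₂ x - star (V₁ x) * U₂ x =
      star (U₁ x - m₁ x) * (V₂ x - n₂ x) + star (U₁ x - m₁ x) * n₂ x +
        star (m₁ x) * (V₂ x - n₂ x) - star (V₁ x - n₁ x) * (U₂ x - m₂ x) -
        star (V₁ x - n₁ x) * m₂ x - star (n₁ x) * (U₂ x - m₂ x) := by
    intro x
    simp only [star_sub]
    linear_combination hid x
  have hsU₁ : Tendsto (fun x ↦ star (U₁ x - m₁ x)) l (𝓝 0) := by simpa using hU₁.star
  have hsV₁ : Tendsto (fun x ↦ star (V₁ x - n₁ x)) l (𝓝 0) := by simpa using hV₁.star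
  have hsm₁ : ∀ᶠ x in l, ‖star (m₁ x)‖ ≤ C₁ := by
    filter_upwards [hm₁] with x hx; rwa [norm_star]
  have hsn₁ : ∀ᶠ x in l, ‖star (n₁ x)‖ ≤ C₃ := by
    filter_upwards [hn₁] with x hx; rwa [norm_star]
  have t1 : Tendsto (fun x ↦ star (U₁ x - m₁ x) * (V₂ x - n₂ x)) l (𝓝 0) := by
    simpa using hsU₁.mul hV₂
  have t2 : Tendsto (fun x ↦ star (U₁ x - m₁ x) * n₂ x) l (𝓝 0) :=
    tendsto_zero_mul_of_norm_le hsU₁ hn₂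
  have t3 : Tendsto (fun x ↦ star (m₁ x) * (V₂ x - n₂ x)) l (𝓝 0) :=
    tendsto_mul_zero_of_norm_le hsm₁ hV₂
  have t4 : Tendsto (fun x ↦ star (V₁ x - n₁ x) * (U₂ x - m₂ x)) l (𝓝 0) := by
    simpa using hsV₁.mul hU₂
  have t5 : Tendsto (fun x ↦ star (V₁ x - n₁ x) * m₂ x) l (𝓝 0) :=
    tendsto_zero_mul_of_norm_le hsV₁ hm₂
  have t6 : Tendsto (fun x ↦ star (n₁ x) * (U₂ x - m₂ x)) l (𝓝 0) :=
    tendsto_mul_zero_of_norm_le hsn₁ hU₂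
  have h := ((((t1.add t2).add t3).sub t4).sub t5).sub t6
  simp only [add_zero, sub_zero] at h
  exact h.congr fun x ↦ (key x).symm

/-- RH-FREE (PROVED). **(1.20) selects the `sin`-phase**: if `x h(x) − (A sin ωx + B cos ωx) → 0`
and `(h + x h′)(x) − ω(A cos ωx − B sin ωx) → 0` at `+∞` (`ω = 2πλ > 0`), then the boundary
condition (1.20) `bcInfEven λ h → 0` forces `B = 0` (indeed `bcInfEven λ h → −ωB`).
[cite: ConnesMoscovici2022, §1 (1.18) `𝓛_{β̂₊}` and (1.20) (= arXiv (2.18), (2.20), chunk p0006:L18–L20, L64–L66)] -/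
theorem cos_coeff_eq_zero_of_bcInfEven (hlam : 0 < lam) {h : ℝ → ℂ} {A B : ℂ}
    (hU : Tendsto (fun x : ℝ ↦ (x : ℂ) * h x -
      (A * (Real.sin (2 * π * lam * x) : ℂ) + B * (Real.cos (2 * π * lam * x) : ℂ))) atTop (𝓝 0))
    (hV : Tendsto (fun x : ℝ ↦ (h x + x * deriv h x) - ((2 * π * lam : ℝ) : ℂ) *
      (A * (Real.cos (2 * π * lam * x) : ℂ) - B * (Real.sin (2 * π * lam * x) : ℂ))) atTop (𝓝 0))
    (hbc : Tendsto (bcInfEven lam h) atTop (𝓝 0)) : B = 0 := by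
  have hω : ((2 * π * lam : ℝ) : ℂ) ≠ 0 := Complex.ofReal_ne_zero.2 (by positivity)
  have key : ∀ x : ℝ, bcInfEven lam h x + ((2 * π * lam : ℝ) : ℂ) * B =
      (Real.sin (2 * π * lam * x) : ℂ) * ((h x + x * deriv h x) - ((2 * π * lam : ℝ) : ℂ) *
        (A * (Real.cos (2 * π * lam * x) : ℂ) - B * (Real.sin (2 * π * lam * x) : ℂ))) -
      ((2 * π * lam : ℝ) : ℂ) * ((Real.cos (2 * π * lam * x) : ℂ) * ((x : ℂ) * h x -
        (A * (Real.sin (2 * π * lam * x) : ℂ) + B * (Real.cos (2 * π * lam * x) : ℂ)))) := by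
    intro x
    rw [bcInfEven_expand]
    linear_combination (-((2 * π * lam : ℝ) : ℂ) * B) * sin_sq_add_cos_sq' (2 * π * lam * x)
  have t1 := tendsto_mul_zero_of_norm_le (b := fun x : ℝ ↦ (Real.sin (2 * π * lam * x) : ℂ))
    (Eventually.of_forall fun x ↦ norm_real_sin_le (2 * π * lam * x)) hV
  have t2 := (tendsto_mul_zero_of_norm_le (b := fun x : ℝ ↦ (Real.cos (2 * π * lam * x) : ℂ))
    (Eventually.of_forall fun x ↦ norm_real_cos_le (2 * π * lam * x)) hU).const_mul
    ((2 * π * lam : ℝ) : ℂ)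
  have h1 : Tendsto (fun x ↦ bcInfEven lam h x + ((2 * π * lam : ℝ) : ℂ) * B) atTop (𝓝 0) := by
    have h := t1.sub t2
    simp only [mul_zero, sub_zero] at h
    exact h.congr fun x ↦ (key x).symm
  have h2 : Tendsto (fun x ↦ bcInfEven lam h x + ((2 * π * lam : ℝ) : ℂ) * B) atTop
      (𝓝 (0 + ((2 * π * lam : ℝ) : ℂ) * B)) := hbc.add_const _
  have h3 := tendsto_nhds_unique h2 h1
  rw [zero_add] at h3
  exact (mul_eq_zero.1 h3).resolve_left hω

/-- RH-FREE (PROVED). **(1.21) selects the `cos`-phase**: under the same asymptotics, the boundary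
condition (1.21) `bcInfOdd λ h → 0` forces `A = 0` (indeed `bcInfOdd λ h → ωA`).
[cite: ConnesMoscovici2022, §1 (1.18) `𝓛_{α̂₊}` and (1.21) (= arXiv (2.18), (2.21), chunk p0006:L15–L17, L67–L69)] -/
theorem sin_coeff_eq_zero_of_bcInfOdd (hlam : 0 < lam) {h : ℝ → ℂ} {A B : ℂ}
    (hU : Tendsto (fun x : ℝ ↦ (x : ℂ) * h x -
      (A * (Real.sin (2 * π * lam * x) : ℂ) + B * (Real.cos (2 * π * lam * x) : ℂ))) atTop (𝓝 0))
    (hV : Tendsto (fun x : ℝ ↦ (h x + x * deriv h x) - ((2 * π * lam : ℝ) : ℂ) *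
      (A * (Real.cos (2 * π * lam * x) : ℂ) - B * (Real.sin (2 * π * lam * x) : ℂ))) atTop (𝓝 0))
    (hbc : Tendsto (bcInfOdd lam h) atTop (𝓝 0)) : A = 0 := by
  have hω : ((2 * π * lam : ℝ) : ℂ) ≠ 0 := Complex.ofReal_ne_zero.2 (by positivity)
  have key : ∀ x : ℝ, bcInfOdd lam h x - ((2 * π * lam : ℝ) : ℂ) * A =
      (Real.cos (2 * π * lam * x) : ℂ) * ((h x + x * deriv h x) - ((2 * π * lam : ℝ) : ℂ) *
        (A * (Real.cos (2 * π * lam * x) : ℂ) - B * (Real.sin (2 * π * lam * x) : ℂ))) +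
      ((2 * π * lam : ℝ) : ℂ) * ((Real.sin (2 * π * lam * x) : ℂ) * ((x : ℂ) * h x -
        (A * (Real.sin (2 * π * lam * x) : ℂ) + B * (Real.cos (2 * π * lam * x) : ℂ)))) := by
    intro x
    rw [bcInfOdd_expand]
    linear_combination (((2 * π * lam : ℝ) : ℂ) * A) * sin_sq_add_cos_sq' (2 * π * lam * x)
  have t1 := tendsto_mul_zero_of_norm_le (b := fun x : ℝ ↦ (Real.cos (2 * π * lam * x) : ℂ))
    (Eventually.of_forall fun x ↦ norm_real_cos_le (2 * π * lam * x)) hV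
  have t2 := (tendsto_mul_zero_of_norm_le (b := fun x : ℝ ↦ (Real.sin (2 * π * lam * x) : ℂ))
    (Eventually.of_forall fun x ↦ norm_real_sin_le (2 * π * lam * x)) hU).const_mul
    ((2 * π * lam : ℝ) : ℂ)
  have h1 : Tendsto (fun x ↦ bcInfOdd lam h x - ((2 * π * lam : ℝ) : ℂ) * A) atTop (𝓝 0) := by
    have h := t1.add t2
    simp only [mul_zero, add_zero] at h
    exact h.congr fun x ↦ (key x).symm
  have h2 : Tendsto (fun x ↦ bcInfOdd lam h x - ((2 * π * lam : ℝ) : ℂ) * A) atTop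
      (𝓝 (0 - ((2 * π * lam : ℝ) : ℂ) * A)) := hbc.sub_const _
  have h3 := tendsto_nhds_unique h2 h1
  rw [zero_sub, neg_eq_zero] at h3
  exact (mul_eq_zero.1 h3).resolve_left hω

/-- RH-FREE (PROVED). **The `sin`-phase form dies at `+∞`**: for two functions with the asymptotics
above and `B₁ = B₂ = 0` (both in the `sin`-phase, as (1.20) forces for even parts), the
sesquilinear form `conj(x h₁)·(h₂ + x h₂′) − conj(h₁ + x h₁′)·(x h₂) → 0`.
[cite: ConnesMoscovici2022, proof of Lemma 1.5 / (1.18) (= arXiv chunk p0005:L94–L104, p0006:L4–L24)] -/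
theorem tendsto_form_zero_of_sin_phase (hlam : 0 < lam) {h₁ h₂ : ℝ → ℂ} {A₁ B₁ A₂ B₂ : ℂ}
    (hU₁ : Tendsto (fun x : ℝ ↦ (x : ℂ) * h₁ x -
      (A₁ * (Real.sin (2 * π * lam * x) : ℂ) + B₁ * (Real.cos (2 * π * lam * x) : ℂ))) atTop (𝓝 0))
    (hV₁ : Tendsto (fun x : ℝ ↦ (h₁ x + x * deriv h₁ x) - ((2 * π * lam : ℝ) : ℂ) *
      (A₁ * (Real.cos (2 * π * lam * x) : ℂ) - B₁ * (Real.sin (2 * π * lam * x) : ℂ))) atTop (𝓝 0))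
    (hU₂ : Tendsto (fun x : ℝ ↦ (x : ℂ) * h₂ x -
      (A₂ * (Real.sin (2 * π * lam * x) : ℂ) + B₂ * (Real.cos (2 * π * lam * x) : ℂ))) atTop (𝓝 0))
    (hV₂ : Tendsto (fun x : ℝ ↦ (h₂ x + x * deriv h₂ x) - ((2 * π * lam : ℝ) : ℂ) *
      (A₂ * (Real.cos (2 * π * lam * x) : ℂ) - B₂ * (Real.sin (2 * π * lam * x) : ℂ))) atTop (𝓝 0))
    (hB₁ : B₁ = 0) (hB₂ : B₂ = 0) :
    Tendsto (fun x : ℝ ↦ star ((x : ℂ) * h₁ x) * (h₂ x + x * deriv h₂ x) -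
      star (h₁ x + x * deriv h₁ x) * ((x : ℂ) * h₂ x)) atTop (𝓝 0) := by
  have _ := hlam
  subst hB₁ hB₂
  refine tendsto_form_zero_of_model
    (U₁ := fun x : ℝ ↦ (x : ℂ) * h₁ x) (U₂ := fun x : ℝ ↦ (x : ℂ) * h₂ x)
    (V₁ := fun x : ℝ ↦ h₁ x + x * deriv h₁ x) (V₂ := fun x : ℝ ↦ h₂ x + x * deriv h₂ x)
    (m₁ := fun x : ℝ ↦ A₁ * (Real.sin (2 * π * lam * x) : ℂ) + 0 * (Real.cos (2 * π * lam * x) : ℂ))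
    (m₂ := fun x : ℝ ↦ A₂ * (Real.sin (2 * π * lam * x) : ℂ) + 0 * (Real.cos (2 * π * lam * x) : ℂ))
    (n₁ := fun x : ℝ ↦ ((2 * π * lam : ℝ) : ℂ) *
      (A₁ * (Real.cos (2 * π * lam * x) : ℂ) - 0 * (Real.sin (2 * π * lam * x) : ℂ)))
    (n₂ := fun x : ℝ ↦ ((2 * π * lam : ℝ) : ℂ) *
      (A₂ * (Real.cos (2 * π * lam * x) : ℂ) - 0 * (Real.sin (2 * π * lam * x) : ℂ)))
    (Eventually.of_forall fun x ↦ norm_sin_cos_comb_le _ _ _)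
    (Eventually.of_forall fun x ↦ norm_sin_cos_comb_le _ _ _)
    (Eventually.of_forall fun x ↦ norm_cos_sin_comb_le _ _ _ _)
    (Eventually.of_forall fun x ↦ norm_cos_sin_comb_le _ _ _ _)
    (fun x ↦ ?_) hU₁ hU₂ hV₁ hV₂
  simp only [star_mul', star_add, star_sub, star_zero, star_ofReal']
  ring

/-- RH-FREE (PROVED). **The `cos`-phase form dies at `+∞`**: same with `A₁ = A₂ = 0` (as (1.21)
forces for odd parts).
[cite: ConnesMoscovici2022, proof of Lemma 1.5 / (1.18) (= arXiv chunk p0005:L94–L104, p0006:L4–L24)] -/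
theorem tendsto_form_zero_of_cos_phase (hlam : 0 < lam) {h₁ h₂ : ℝ → ℂ} {A₁ B₁ A₂ B₂ : ℂ}
    (hU₁ : Tendsto (fun x : ℝ ↦ (x : ℂ) * h₁ x -
      (A₁ * (Real.sin (2 * π * lam * x) : ℂ) + B₁ * (Real.cos (2 * π * lam * x) : ℂ))) atTop (𝓝 0))
    (hV₁ : Tendsto (fun x : ℝ ↦ (h₁ x + x * deriv h₁ x) - ((2 * π * lam : ℝ) : ℂ) *
      (A₁ * (Real.cos (2 * π * lam * x) : ℂ) - B₁ * (Real.sin (2 * π * lam * x) : ℂ))) atTop (𝓝 0))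
    (hU₂ : Tendsto (fun x : ℝ ↦ (x : ℂ) * h₂ x -
      (A₂ * (Real.sin (2 * π * lam * x) : ℂ) + B₂ * (Real.cos (2 * π * lam * x) : ℂ))) atTop (𝓝 0))
    (hV₂ : Tendsto (fun x : ℝ ↦ (h₂ x + x * deriv h₂ x) - ((2 * π * lam : ℝ) : ℂ) *
      (A₂ * (Real.cos (2 * π * lam * x) : ℂ) - B₂ * (Real.sin (2 * π * lam * x) : ℂ))) atTop (𝓝 0))
    (hA₁ : A₁ = 0) (hA₂ : A₂ = 0) :
    Tendsto (fun x : ℝ ↦ star ((x : ℂ) * h₁ x) * (h₂ x + x * deriv h₂ x) -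
      star (h₁ x + x * deriv h₁ x) * ((x : ℂ) * h₂ x)) atTop (𝓝 0) := by
  have _ := hlam
  subst hA₁ hA₂
  refine tendsto_form_zero_of_model
    (U₁ := fun x : ℝ ↦ (x : ℂ) * h₁ x) (U₂ := fun x : ℝ ↦ (x : ℂ) * h₂ x)
    (V₁ := fun x : ℝ ↦ h₁ x + x * deriv h₁ x) (V₂ := fun x : ℝ ↦ h₂ x + x * deriv h₂ x)
    (m₁ := fun x : ℝ ↦ 0 * (Real.sin (2 * π * lam * x) : ℂ) + B₁ * (Real.cos (2 * π * lam * x) : ℂ))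
    (m₂ := fun x : ℝ ↦ 0 * (Real.sin (2 * π * lam * x) : ℂ) + B₂ * (Real.cos (2 * π * lam * x) : ℂ))
    (n₁ := fun x : ℝ ↦ ((2 * π * lam : ℝ) : ℂ) *
      (0 * (Real.cos (2 * π * lam * x) : ℂ) - B₁ * (Real.sin (2 * π * lam * x) : ℂ)))
    (n₂ := fun x : ℝ ↦ ((2 * π * lam : ℝ) : ℂ) *
      (0 * (Real.cos (2 * π * lam * x) : ℂ) - B₂ * (Real.sin (2 * π * lam * x) : ℂ)))
    (Eventually.of_forall fun x ↦ norm_sin_cos_comb_le _ _ _)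
    (Eventually.of_forall fun x ↦ norm_sin_cos_comb_le _ _ _)
    (Eventually.of_forall fun x ↦ norm_cos_sin_comb_le _ _ _ _)
    (Eventually.of_forall fun x ↦ norm_cos_sin_comb_le _ _ _ _)
    (fun x ↦ ?_) hU₁ hU₂ hV₁ hV₂
  simp only [star_mul', star_add, star_sub, star_zero, star_ofReal']
  ring

/-- RH-FREE (PROVED). **From the two phase forms to `BF(R) − BF(−R) → 0`.**  For regular
representatives `g₁, g₂` (`C¹` off `{±λ}`), if the `sin`-phase form of the even parts and the
`cos`-phase form of the odd parts die at `+∞`, then `BF(R) − BF(−R) → 0` (`BF` the sesquilinear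
Lagrange boundary form of `UVProlateSymmetryReduction`; `BF = (p/x²)·form`, `p/x² → −1`).
[cite: ConnesMoscovici2022, proof of Thm 1.6 (i) via (1.7)–(1.8) (= arXiv (2.7)–(2.8), chunk p0005:L33–L55; p0006:L81–L83)] -/
theorem tendsto_boundaryForm_sub_reflect_zero (hlam : 0 < lam) {g₁ g₂ : ℝ → ℂ}
    (hg₁ : ContDiffOn ℝ 1 g₁ {x | x ≠ lam ∧ x ≠ -lam})
    (hg₂ : ContDiffOn ℝ 1 g₂ {x | x ≠ lam ∧ x ≠ -lam})
    (hE : Tendsto (fun x : ℝ ↦ star ((x : ℂ) * evenFn g₁ x) * (evenFn g₂ x + x * deriv (evenFn g₂) x) -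
      star (evenFn g₁ x + x * deriv (evenFn g₁) x) * ((x : ℂ) * evenFn g₂ x)) atTop (𝓝 0))
    (hO : Tendsto (fun x : ℝ ↦ star ((x : ℂ) * oddFn g₁ x) * (oddFn g₂ x + x * deriv (oddFn g₂) x) -
      star (oddFn g₁ x + x * deriv (oddFn g₁) x) * ((x : ℂ) * oddFn g₂ x)) atTop (𝓝 0)) :
    Tendsto (fun R : ℝ ↦
      (star (g₁ R) * (pCoeff lam R * deriv g₂ R) - star (pCoeff lam R * deriv g₁ R) * g₂ R) -
        (star (g₁ (-R)) * (pCoeff lam (-R) * deriv g₂ (-R)) -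
          star (pCoeff lam (-R) * deriv g₁ (-R)) * g₂ (-R))) atTop (𝓝 0) := by
  have hsum : Tendsto (fun x : ℝ ↦ 2 *
      ((star ((x : ℂ) * evenFn g₁ x) * (evenFn g₂ x + x * deriv (evenFn g₂) x) -
        star (evenFn g₁ x + x * deriv (evenFn g₁) x) * ((x : ℂ) * evenFn g₂ x)) +
      (star ((x : ℂ) * oddFn g₁ x) * (oddFn g₂ x + x * deriv (oddFn g₂) x) -
        star (oddFn g₁ x + x * deriv (oddFn g₁) x) * ((x : ℂ) * oddFn g₂ x)))) atTop (𝓝 0) := by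
    simpa using (hE.add hO).const_mul (2 : ℂ)
  have hcoef : ∀ᶠ R : ℝ in atTop, ‖pCoeff lam R / (R : ℂ) ^ 2‖ ≤ lam ^ 2 + 1 := by
    filter_upwards [eventually_ge_atTop (1 : ℝ)] with R hR
    have hR0 : (0 : ℝ) < R := by linarith
    rw [pCoeff, norm_div, norm_pow, Complex.norm_real, Complex.norm_real, Real.norm_eq_abs,
      Real.norm_eq_abs, abs_of_pos hR0, div_le_iff₀ (by positivity)]
    have h := abs_sub (lam ^ 2) (R ^ 2)
    rw [abs_of_nonneg (sq_nonneg lam), abs_of_nonneg (sq_nonneg R)] at h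
    have hR2 : 1 ≤ R ^ 2 := by nlinarith [hR]
    nlinarith [mul_nonneg (sq_nonneg lam) (sub_nonneg.2 hR2), h]
  have hmain := tendsto_mul_zero_of_norm_le hcoef hsum
  refine hmain.congr' ?_
  filter_upwards [eventually_gt_atTop lam] with R hR
  have hR0 : R ≠ 0 := by intro h; rw [h] at hR; exact absurd hR (not_lt.2 hlam.le)
  have hRU : R ∈ {x : ℝ | x ≠ lam ∧ x ≠ -lam} := ⟨ne_of_gt hR, by intro h; linarith⟩
  have hR2 : (R : ℂ) ^ 2 ≠ 0 := pow_ne_zero 2 (Complex.ofReal_ne_zero.2 hR0)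
  rw [boundaryForm_sub_reflect_eq hg₁ hg₂ hRU]
  have eE : star ((R : ℂ) * evenFn g₁ R) * (evenFn g₂ R + R * deriv (evenFn g₂) R) -
      star (evenFn g₁ R + R * deriv (evenFn g₁) R) * ((R : ℂ) * evenFn g₂ R) =
      (R : ℂ) ^ 2 * (star (evenFn g₁ R) * deriv (evenFn g₂) R -
        star (deriv (evenFn g₁) R) * evenFn g₂ R) := by
    simp only [star_mul', star_add, star_ofReal']
    ring
  have eO : star ((R : ℂ) * oddFn g₁ R) * (oddFn g₂ R + R * deriv (oddFn g₂) R) -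
      star (oddFn g₁ R + R * deriv (oddFn g₁) R) * ((R : ℂ) * oddFn g₂ R) =
      (R : ℂ) ^ 2 * (star (oddFn g₁ R) * deriv (oddFn g₂) R -
        star (deriv (oddFn g₁) R) * oddFn g₂ R) := by
    simp only [star_mul', star_add, star_ofReal']
    ring
  rw [eE, eO]
  have hc : pCoeff lam R / (R : ℂ) ^ 2 * (R : ℂ) ^ 2 = pCoeff lam R := div_mul_cancel₀ _ hR2
  linear_combination (2 * ((star (evenFn g₁ R) * deriv (evenFn g₂) R -
    star (deriv (evenFn g₁) R) * evenFn g₂ R) + (star (oddFn g₁ R) * deriv (oddFn g₂) R -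
    star (deriv (oddFn g₁) R) * oddFn g₂ R))) * hc

end LimitAlgebra

/-! ## Assembly: symmetry of `W_max` on `𝓛_β`, assuming the `+∞` asymptotics of `dom W_max` -/

section Assembly

variable {lam : ℝ}

/-- RH-FREE (PROVED). A regular representative of an element of `𝓛_β` with ALL boundary data:
`C¹` off `{±λ}`, the FTC form of `(p g′)′ = q g − W_max ξ`, (1.19) in the four one-sided forms, the
one-sided limits of `g` at `±λ`, and (1.20)/(1.21) at `+∞` for its even/odd parts.
[cite: ConnesMoscovici2022, §1 Definition before Thm 1.6, (1.19)–(1.21) (= arXiv chunk p0006:L52–L69); Lemma 1.2 (= arXiv Lemma 2.2, p0004:L50–L101)] -/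
theorem exists_regular_repr_bc_of_mem_prolateSASet (hlam : 0 < lam) {ξ : L2R}
    (hξ : ξ ∈ prolateSASet lam) :
    ∃ g : ℝ → ℂ, ((ξ : ℝ → ℂ)) =ᵐ[volume] g ∧
      ContDiffOn ℝ 1 g {x | x ≠ lam ∧ x ≠ -lam} ∧
      (∀ x y, x ≤ y → Icc x y ⊆ {x | x ≠ lam ∧ x ≠ -lam} →
        pCoeff lam y * deriv g y - pCoeff lam x * deriv g x =
          ∫ t in x..y, (qCoeff lam t * g t - (prolateMax lam ⟨ξ, hξ.1⟩ : L2R) t)) ∧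
      (∀ a, a = lam ∨ a = -lam →
        Tendsto (fun x ↦ pCoeff lam x * deriv g x) (𝓝[>] a) (𝓝 0) ∧
        Tendsto (fun x ↦ pCoeff lam x * deriv g x) (𝓝[<] a) (𝓝 0)) ∧
      (∀ a, a = lam ∨ a = -lam →
        (∃ c, Tendsto g (𝓝[>] a) (𝓝 c)) ∧ (∃ c, Tendsto g (𝓝[<] a) (𝓝 c))) ∧
      Tendsto (bcInfEven lam (evenFn g)) atTop (𝓝 0) ∧
      Tendsto (bcInfOdd lam (oddFn g)) atTop (𝓝 0) := by
  obtain ⟨g, hae, hg, hftc, -, hT, hL⟩ := exists_regular_repr_of_mem_prolateSASet hlam hξ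
  obtain ⟨g₀, hae₀, hbc₀⟩ := hξ.2
  have h0g : g₀ =ᵐ[volume] g := hae₀.symm.trans hae
  obtain ⟨hE, hO⟩ := bcInf_transfer h0g hbc₀.differentiableOn hg hbc₀
  exact ⟨g, hae, hg, hftc, hT, hL, hE, hO⟩

/-- RH-FREE (PROVED, modulo the explicit hypothesis `hB`). **Connes–Moscovici Thm 1.6 (i),
symmetric half: `⟪W_max ξ₁, ξ₂⟫ = ⟪ξ₁, W_max ξ₂⟫` for `ξ₁, ξ₂ ∈ 𝓛_β = prolateSASet λ`**, i.e.
`Ω` vanishes on `𝓛_β × 𝓛_β` / the restriction `W_sa` of `W_max` to `𝓛_β` is a symmetric operator.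
The hypothesis `hB` is the general `+∞` asymptotics of elements of `dom W_max` («the known form of
the solutions around `±∞`»): for `g ∈ C¹(x₀, ∞) ∩ L²`, `x₀ > λ`, with `p g′` a primitive of
`q g − η`, `η ∈ L²(x₀, ∞)`, there are `A, B` with `x g(x) − (A sin ωx + B cos ωx) → 0` and
`(g + x g′)(x) − ω(A cos ωx − B sin ωx) → 0`, `ω = 2πλ` — NOT proved in this file.  Given it: the
regular representatives (`exists_regular_repr_bc_of_mem_prolateSASet`) have even/odd parts with
such asymptotics (`ftc_evenFn`/`ftc_oddFn`, `memLp_evenFn`/`memLp_oddFn`), (1.20)/(1.21) force the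
`sin`-phase resp. `cos`-phase (`cos_coeff_eq_zero_of_bcInfEven`, `sin_coeff_eq_zero_of_bcInfOdd`), the phase
forms die (`tendsto_form_zero_of_sin_phase`/`…cos_phase`), so `BF(R) − BF(−R) → 0`
(`tendsto_boundaryForm_sub_reflect_zero`) and `inner_prolateMax_symm_of_tendsto_boundaryForm`
concludes.
[cite: ConnesMoscovici2022, Thm 1.6 (i) (= arXiv:2112.05500 Thm 2.6 (i), chunk p0006:L76–L83), with (1.7)–(1.8) and (1.18)–(1.21)] -/
theorem inner_prolateMax_symm_of_mem_prolateSASet (hlam : 0 < lam)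
    (hB : ∀ (x₀ : ℝ) (g η : ℝ → ℂ), lam < x₀ → ContDiffOn ℝ 1 g (Ioi x₀) →
      IntegrableOn (fun x ↦ ‖g x‖ ^ 2) (Ioi x₀) → IntegrableOn (fun x ↦ ‖η x‖ ^ 2) (Ioi x₀) →
      AEStronglyMeasurable η (volume.restrict (Ioi x₀)) →
      (∀ x y, x₀ < x → x ≤ y →
        pCoeff lam y * deriv g y - pCoeff lam x * deriv g x =
          ∫ t in x..y, (qCoeff lam t * g t - η t)) →
      ∃ A B : ℂ,
        Tendsto (fun x : ℝ ↦ (x : ℂ) * g x -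
          (A * (Real.sin (2 * π * lam * x) : ℂ) + B * (Real.cos (2 * π * lam * x) : ℂ))) atTop (𝓝 0) ∧
        Tendsto (fun x : ℝ ↦ (g x + x * deriv g x) - ((2 * π * lam : ℝ) : ℂ) *
          (A * (Real.cos (2 * π * lam * x) : ℂ) - B * (Real.sin (2 * π * lam * x) : ℂ))) atTop (𝓝 0))
    {ξ₁ ξ₂ : L2R} (hξ₁ : ξ₁ ∈ prolateSASet lam) (hξ₂ : ξ₂ ∈ prolateSASet lam) :
    ⟪(prolateMax lam ⟨ξ₁, hξ₁.1⟩ : L2R), ξ₂⟫_ℂ = ⟪ξ₁, (prolateMax lam ⟨ξ₂, hξ₂.1⟩ : L2R)⟫_ℂ := by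
  obtain ⟨g₁, hae₁, hg₁, hftc₁, hT₁, hL₁, hE₁, hO₁⟩ :=
    exists_regular_repr_bc_of_mem_prolateSASet hlam hξ₁
  obtain ⟨g₂, hae₂, hg₂, hftc₂, hT₂, hL₂, hE₂, hO₂⟩ :=
    exists_regular_repr_bc_of_mem_prolateSASet hlam hξ₂
  set η₁ : L2R := prolateMax lam ⟨ξ₁, hξ₁.1⟩ with hη₁
  set η₂ : L2R := prolateMax lam ⟨ξ₂, hξ₂.1⟩ with hη₂
  -- the data `hB` needs, for the even/odd parts of `g₁, g₂`
  have hx₀ : lam < lam + 1 := by linarith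
  have hIoi : Ioi (lam + 1) ⊆ {x : ℝ | x ≠ lam ∧ x ≠ -lam} := fun x hx ↦
    ⟨by intro h; simp only [mem_Ioi] at hx; linarith, by intro h; simp only [mem_Ioi] at hx; linarith⟩
  have hIcc : ∀ x y : ℝ, lam + 1 < x → Icc x y ⊆ {x : ℝ | x ≠ lam ∧ x ≠ -lam} :=
    fun x y hx t ht ↦ ⟨by intro h; linarith [ht.1], by intro h; linarith [ht.1]⟩
  have hmg₁ : MemLp g₁ 2 volume := (Lp.memLp ξ₁).ae_eq hae₁
  have hmg₂ : MemLp g₂ 2 volume := (Lp.memLp ξ₂).ae_eq hae₂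
  have hmη₁ : MemLp (fun t ↦ ((η₁ : ℝ → ℂ)) t) 2 volume := Lp.memLp η₁
  have hmη₂ : MemLp (fun t ↦ ((η₂ : ℝ → ℂ)) t) 2 volume := Lp.memLp η₂
  have hiη₁ : ∀ a b, IntervalIntegrable (fun t ↦ ((η₁ : ℝ → ℂ)) t) volume a b :=
    intervalIntegrable_coe' η₁
  have hiη₂ : ∀ a b, IntervalIntegrable (fun t ↦ ((η₂ : ℝ → ℂ)) t) volume a b :=
    intervalIntegrable_coe' η₂
  -- even parts
  obtain ⟨A₁, B₁, hU₁, hV₁⟩ := hB (lam + 1) (evenFn g₁) (evenFn fun t ↦ ((η₁ : ℝ → ℂ)) t) hx₀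
    ((contDiffOn_evenFn hg₁).mono hIoi) (integrableOn_sq_of_memLp (memLp_evenFn hmg₁) _)
    (integrableOn_sq_of_memLp (memLp_evenFn hmη₁) _) (memLp_evenFn hmη₁).1.restrict
    (fun x y hx hxy ↦ ftc_evenFn hg₁ hftc₁ hiη₁ x y hxy (hIcc x y hx))
  obtain ⟨A₂, B₂, hU₂, hV₂⟩ := hB (lam + 1) (evenFn g₂) (evenFn fun t ↦ ((η₂ : ℝ → ℂ)) t) hx₀
    ((contDiffOn_evenFn hg₂).mono hIoi) (integrableOn_sq_of_memLp (memLp_evenFn hmg₂) _)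
    (integrableOn_sq_of_memLp (memLp_evenFn hmη₂) _) (memLp_evenFn hmη₂).1.restrict
    (fun x y hx hxy ↦ ftc_evenFn hg₂ hftc₂ hiη₂ x y hxy (hIcc x y hx))
  -- odd parts
  obtain ⟨A₁', B₁', hU₁', hV₁'⟩ := hB (lam + 1) (oddFn g₁) (oddFn fun t ↦ ((η₁ : ℝ → ℂ)) t) hx₀
    ((contDiffOn_oddFn hg₁).mono hIoi) (integrableOn_sq_of_memLp (memLp_oddFn hmg₁) _)
    (integrableOn_sq_of_memLp (memLp_oddFn hmη₁) _) (memLp_oddFn hmη₁).1.restrict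
    (fun x y hx hxy ↦ ftc_oddFn hg₁ hftc₁ hiη₁ x y hxy (hIcc x y hx))
  obtain ⟨A₂', B₂', hU₂', hV₂'⟩ := hB (lam + 1) (oddFn g₂) (oddFn fun t ↦ ((η₂ : ℝ → ℂ)) t) hx₀
    ((contDiffOn_oddFn hg₂).mono hIoi) (integrableOn_sq_of_memLp (memLp_oddFn hmg₂) _)
    (integrableOn_sq_of_memLp (memLp_oddFn hmη₂) _) (memLp_oddFn hmη₂).1.restrict
    (fun x y hx hxy ↦ ftc_oddFn hg₂ hftc₂ hiη₂ x y hxy (hIcc x y hx))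
  -- the boundary conditions select the phases
  have hB₁ : B₁ = 0 := cos_coeff_eq_zero_of_bcInfEven hlam hU₁ hV₁ hE₁
  have hB₂ : B₂ = 0 := cos_coeff_eq_zero_of_bcInfEven hlam hU₂ hV₂ hE₂
  have hA₁ : A₁' = 0 := sin_coeff_eq_zero_of_bcInfOdd hlam hU₁' hV₁' hO₁
  have hA₂ : A₂' = 0 := sin_coeff_eq_zero_of_bcInfOdd hlam hU₂' hV₂' hO₂
  have hinf := tendsto_boundaryForm_sub_reflect_zero hlam hg₁ hg₂
    (tendsto_form_zero_of_sin_phase hlam hU₁ hV₁ hU₂ hV₂ hB₁ hB₂)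
    (tendsto_form_zero_of_cos_phase hlam hU₁' hV₁' hU₂' hV₂' hA₁ hA₂)
  exact inner_prolateMax_symm_of_tendsto_boundaryForm hlam hξ₁.1 hξ₂.1 hae₁ hg₁ hftc₁ hT₁ hL₁
    hae₂ hg₂ hftc₂ hT₂ hL₂ hinf

/-- RH-FREE (PROVED). **Connes–Moscovici Thm 1.6 (i), symmetric half, UNCONDITIONAL:
`⟪W_max ξ₁, ξ₂⟫ = ⟪ξ₁, W_max ξ₂⟫` for all `ξ₁, ξ₂ ∈ 𝓛_β = prolateSASet λ`** (`λ > 0`), i.e. the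
form `Ω` of (1.4) vanishes on `𝓛_β × 𝓛_β`.  The `+∞` asymptotics hypothesis of
`inner_prolateMax_symm_of_mem_prolateSASet` is discharged by `exists_asymptotics_atTop_of_ftc`
(module `UVProlateMaxDomainAsymptotics`).
[cite: ConnesMoscovici2022, Thm 1.6 (i) (= arXiv:2112.05500 Thm 2.6 (i), chunk p0006:L76–L83)] -/
theorem inner_prolateMax_symm (hlam : 0 < lam) {ξ₁ ξ₂ : L2R} (hξ₁ : ξ₁ ∈ prolateSASet lam)
    (hξ₂ : ξ₂ ∈ prolateSASet lam) :
    ⟪(prolateMax lam ⟨ξ₁, hξ₁.1⟩ : L2R), ξ₂⟫_ℂ = ⟪ξ₁, (prolateMax lam ⟨ξ₂, hξ₂.1⟩ : L2R)⟫_ℂ :=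
  inner_prolateMax_symm_of_mem_prolateSASet hlam
    (fun _ _ _ _ hg _ hηL2 hηm hftc ↦ exists_asymptotics_atTop_of_ftc hlam hg hftc hηm hηL2) hξ₁ hξ₂

/-- RH-FREE (PROVED). **`W_sa` is a symmetric operator**: for any `W` with `IsProlateSA λ W` (the
restriction of `W_max` to `𝓛_β`), `⟪W ξ, η⟫ = ⟪ξ, W η⟫` for all `ξ, η ∈ dom W` — the tree's
`LinearPMap.IsSymmetric` (`= W.IsFormalAdjoint W`).
[cite: ConnesMoscovici2022, Thm 1.6 (i) (= arXiv:2112.05500 Thm 2.6 (i), chunk p0006:L76–L83)] -/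
theorem isSymmetric_of_isProlateSA (hlam : 0 < lam) {W : L2R →ₗ.[ℂ] L2R}
    (hW : IsProlateSA lam W) : W.IsSymmetric := by
  rw [LinearPMap.isSymmetric_iff]
  intro ξ η
  have hξ : (ξ : L2R) ∈ prolateSASet lam := by rw [← hW.2]; exact ξ.2
  have hη : (η : L2R) ∈ prolateSASet lam := by rw [← hW.2]; exact η.2
  have e₁ : W ξ = prolateMax lam ⟨ξ, hξ.1⟩ := hW.1.2 rfl
  have e₂ : W η = prolateMax lam ⟨η, hη.1⟩ := hW.1.2 rfl
  rw [e₁, e₂]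
  exact inner_prolateMax_symm hlam hξ hη

/-- RH-FREE (PROVED). **Thm 1.6 (i), symmetric half, for THE operator `prolateSA λ`** (the tree's
`W_sa`): `(prolateSA λ).IsSymmetric`.
[cite: ConnesMoscovici2022, Thm 1.6 (i) (= arXiv:2112.05500 Thm 2.6 (i), chunk p0006:L76–L83)] -/
theorem prolateSA_isSymmetric (hlam : 0 < lam) : (prolateSA lam hlam).IsSymmetric :=
  isSymmetric_of_isProlateSA hlam (isProlateSA_prolateSA hlam)

end Assembly

end Literature.NumberTheory.ConnesMoscovici2022
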